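import Mathlib

/-!
# Radius bootstrap of crux 14294, stub W4: the frame count

Crux `StackingFaultSparsity` (stmt-AtomisticToContinuum-14296), line `Sketch`, reshape 14 (lead c8): registered stub
`stub_frameCount`.  A site with a GOOD`(2, 1, ε)` frame, `ε ≤ 1/100`, has exactly twelve other particles within
distance `1`: levels two apart differ in height by `≥ 2 · 19/25`, flatness costs `2ε`, so every particle within `1`
is at level `l i`, `l i + 1` or `l i − 1`, and the three registered counts add up.  All `[folklore]`.
-/

noncomputable section

namespace Summit.AtomisticToContinuum.Crystallization.Theorems.SquareWellLayerCake.StackingFaultSparsity.Bootstrap.FrameCount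

/-- Splitting a `Nat.card` of a subtype of `Fin N` along a trichotomy into three pairwise
disjoint pieces. -/
private lemma card_split {N : ℕ} (P A B C : Fin N → Prop) (hP : ∀ k, P k ↔ A k ∨ B k ∨ C k)
    (hAB : ∀ k, A k → B k → False) (hAC : ∀ k, A k → C k → False)
    (hBC : ∀ k, B k → C k → False) :
    Nat.card {k // P k} = Nat.card {k // A k} + Nat.card {k // B k} + Nat.card {k // C k} := by
  classical
  have e : ∀ Q : Fin N → Prop, Nat.card {k // Q k} = (Finset.univ.filter Q).card := fun Q =>
    Nat.subtype_card _ (fun x => by simp)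
  have hAB' : Disjoint (Finset.univ.filter A) (Finset.univ.filter B) :=
    Finset.disjoint_filter.2 (fun k _ hA hB => hAB k hA hB)
  have hABC' : Disjoint (Finset.univ.filter A ∪ Finset.univ.filter B) (Finset.univ.filter C) := by
    rw [Finset.disjoint_union_left]
    exact ⟨Finset.disjoint_filter.2 (fun k _ hA hC => hAC k hA hC),
      Finset.disjoint_filter.2 (fun k _ hB hC => hBC k hB hC)⟩
  have hunion : Finset.univ.filter P =
      (Finset.univ.filter A ∪ Finset.univ.filter B) ∪ Finset.univ.filter C := by
    ext k
    simp only [Finset.mem_filter, Finset.mem_union, Finset.mem_univ, true_and]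
    rw [hP k, or_assoc]
  rw [e P, e A, e B, e C, hunion, Finset.card_union_of_disjoint hABC',
    Finset.card_union_of_disjoint hAB']

/-- Levels with consecutive gaps `≥ 19/25` grow at least linearly. -/
private lemma level_growth (c : ℤ → ℝ) (hc : ∀ k : ℤ, c k + 19 / 25 ≤ c (k + 1)) :
    ∀ (m : ℤ) (d : ℕ), c m + d * (19 / 25) ≤ c (m + d) := by
  intro m d
  induction d with
  | zero => simp
  | succ d ih =>
    have h := hc (m + d)
    have e : m + ((d + 1 : ℕ) : ℤ) = m + d + 1 := by push_cast; ring
    rw [e]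
    push_cast
    linarith

/-- Levels two or more apart differ in height by at least `38/25`. -/
private lemma level_gap_two (c : ℤ → ℝ) (hc : ∀ k : ℤ, c k + 19 / 25 ≤ c (k + 1)) :
    ∀ m m' : ℤ, m + 2 ≤ m' → c m + 38 / 25 ≤ c m' := by
  intro m m' hmm'
  obtain ⟨d, hd⟩ : ∃ d : ℕ, m' = m + 2 + d := ⟨(m' - (m + 2)).toNat, by omega⟩
  have h1 := level_growth c hc m 2
  have h2 := level_growth c hc (m + 2) d
  have h3 : (0 : ℝ) ≤ (d : ℝ) * (19 / 25) := by positivity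
  rw [hd]
  push_cast at h1 h2 ⊢
  linarith

/-- **Stub `stub_frameCount` of line `Sketch` (reshape 14), by name and signature.** [folklore] -/
theorem stub_frameCount :
    ∀ (N : ℕ) (y : Fin N → EuclideanSpace ℝ (Fin 3)) (i : Fin N) (ε : ℝ), 0 ≤ ε → ε ≤ 1 / 100 → (∃ a b : ℝ, 19 / 20 ≤ a ∧ a ≤ 1 ∧ 19 / 20 ≤ b ∧ b ≤ 1 ∧ ∃ n : EuclideanSpace ℝ (Fin 3), ‖n‖ = 1 ∧ ∃ c : ℤ → ℝ, (∀ k : ℤ, c k + 19 / 25 ≤ c (k + 1)) ∧ ∃ l : Fin N → ℤ, (∀ j : Fin N, dist (y j) (y i) ≤ 2 → |inner ℝ (y j - y i) n - c (l j)| ≤ ε) ∧ (∀ j k : Fin N, dist (y j) (y i) ≤ 2 → dist (y k) (y i) ≤ 2 → j ≠ k → 19 / 20 ≤ dist (y j) (y k)) ∧ ∀ j : Fin N, dist (y j) (y i) ≤ 1 → Nat.card {k : Fin N // k ≠ j ∧ l k = l j ∧ dist (y j) (y k) ≤ 1} = 6 ∧ Nat.card {k : Fin N // l k = l j + 1 ∧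 dist (y j) (y k) ≤ 1} = 3 ∧ Nat.card {k : Fin N // l k = l j - 1 ∧ dist (y j) (y k) ≤ 1} = 3 ∧ ∀ k : Fin N, k ≠ j → dist (y j) (y k) ≤ 1 → (l k = l j → |dist (y j) (y k) - a| ≤ ε) ∧ (l k ≠ l j → |dist (y j) (y k) - b| ≤ ε)) → Nat.card {k : Fin N // k ≠ i ∧ dist (y i) (y k) ≤ 1} = 12 := by
  intro N y i ε hε0 hε1 hyp
  obtain ⟨a, b, -, -, -, -, n, hn, c, hc, l, hflat, -, hcount⟩ := hyp
  have hii : dist (y i) (y i) ≤ 1 := by simp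
  obtain ⟨h6, h3u, h3d, -⟩ := hcount i hii
  -- every particle within `1` of `y i` sits at level `l i`, `l i + 1` or `l i - 1`
  have htri : ∀ k : Fin N, dist (y i) (y k) ≤ 1 →
      (l k = l i ∨ l k = l i + 1 ∨ l k = l i - 1) := by
    intro k hk
    have hki : dist (y k) (y i) ≤ 2 := by rw [dist_comm]; linarith
    have hfk := hflat k hki
    have hfi := hflat i (by simp)
    simp only [sub_self, inner_zero_left, zero_sub, abs_neg] at hfi
    have hcs : |inner ℝ (y k - y i) n| ≤ 1 := by
      calc |inner ℝ (y k - y i) n| ≤ ‖y k - y i‖ * ‖n‖ := abs_real_inner_le_norm _ _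
        _ = dist (y k) (y i) := by rw [hn, mul_one, dist_eq_norm]
        _ ≤ 1 := by rw [dist_comm]; exact hk
    rw [abs_le] at hfk hfi hcs
    rcases lt_trichotomy (l k) (l i) with h | h | h
    · by_cases h' : l k = l i - 1
      · exact Or.inr (Or.inr h')
      · exfalso
        have h2 : l k + 2 ≤ l i := by omega
        have := level_gap_two c hc _ _ h2
        linarith [hfk.1, hfk.2, hfi.1, hfi.2, hcs.1, hcs.2]
    · exact Or.inl h
    · by_cases h' : l k = l i + 1
      · exact Or.inr (Or.inl h')
      · exfalso
        have h2 : l i + 2 ≤ l k := by omega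
        have := level_gap_two c hc _ _ h2
        linarith [hfk.1, hfk.2, hfi.1, hfi.2, hcs.1, hcs.2]
  have key := card_split (fun k => k ≠ i ∧ dist (y i) (y k) ≤ 1)
    (fun k => k ≠ i ∧ l k = l i ∧ dist (y i) (y k) ≤ 1)
    (fun k => l k = l i + 1 ∧ dist (y i) (y k) ≤ 1)
    (fun k => l k = l i - 1 ∧ dist (y i) (y k) ≤ 1) ?_ ?_ ?_ ?_
  · rw [key, h6, h3u, h3d]
  · intro k
    constructor
    · rintro ⟨hki, hd⟩
      rcases htri k hd with h | h | h
      · exact Or.inl ⟨hki, h, hd⟩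
      · exact Or.inr (Or.inl ⟨h, hd⟩)
      · exact Or.inr (Or.inr ⟨h, hd⟩)
    · rintro (⟨hki, -, hd⟩ | ⟨h, hd⟩ | ⟨h, hd⟩)
      · exact ⟨hki, hd⟩
      · refine ⟨?_, hd⟩
        rintro rfl
        omega
      · refine ⟨?_, hd⟩
        rintro rfl
        omega
  · rintro k ⟨-, h1, -⟩ ⟨h2, -⟩
    omega
  · rintro k ⟨-, h1, -⟩ ⟨h2, -⟩
    omega
  · rintro k ⟨h1, -⟩ ⟨h2, -⟩
    omega

end Summit.AtomisticToContinuum.Crystallization.Theorems.SquareWellLayerCake.StackingFaultSparsity.Bootstrap.FrameCount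

end
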